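import Mathlib
import Summits.BirchSwinnertonDyer.BirchSwinnertonDyer.Theorems.ResidualThetaTransportAtTwoSignedMuSeedAtTwoPlusNonsquareDescentCertificate
import Summits.BirchSwinnertonDyer.BirchSwinnertonDyer.Theorems.ResidualThetaTransportAtTwoSignedMuSeedAtTwoPlusNonsquareDescentRankOneModP
import Summits.BirchSwinnertonDyer.BirchSwinnertonDyer.Theorems.ResidualThetaTransportAtTwoSignedMuSeedAtTwoPlusNonsquareDescentRankOneNonTorsion
import Summits.BirchSwinnertonDyer.BirchSwinnertonDyer.Theorems.ResidualThetaTransportAtTwoSignedMuSeedAtTwoPlusNonsquareDescentRankOneEmbedding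
import Summits.BirchSwinnertonDyer.BirchSwinnertonDyer.Theorems.ResidualThetaTransportAtTwoSignedMuSeedAtTwoPlusNonsquareDescentModPStructure
import Summits.BirchSwinnertonDyer.BirchSwinnertonDyer.Theorems.ResidualThetaTransportAtTwoSignedMuSeedAtTwoPlusNonsquareDescentRankOnePowerSeries
import HarnessLib

/-!
# Non-square descent — THE S3 (c) CERTIFICATE «`μ(Q') = 0 ⟺ ∃ m GNS(m)`» WITH ITS RANK-ONE INPUTS DERIVED FROM THE LATTICE `Ē^χ ↪ Λ'`
# (seed crux `SignedMuSeedAtTwoPlus` stmt-BirchSwinnertonDyer-21438; parent Kμ⁺ `SignedMuVanishingAtTwoPlus` stmt-BirchSwinnertonDyer-20689,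
# route ResidualThetaTransportAtTwo; line card `Cruxes/SignedMuSeedAtTwoPlus/Lines/nonsquare-descent.md`)

Cell `bsd-wall`, width seat `bsd-wall-rtt-p4-w2` g18 (`--supports`, closes nothing).  THEOREMS ONLY; BSD is not proved by this and
nothing arithmetic is asserted: composition of module algebra already in the tree.

Seat g17's certificate `isTorsion_quotient_iff_exists_proj_ne_zero` (`Theorems/…NonsquareDescentCertificate.lean`): under the
squares-dichotomy tower hypotheses, «`V_∞ ⧸ ⟨ū_∞⟩` (= `Q'/2`) is torsion ⟺ `ū_m ≠ 0` for some `m`», GIVEN `hrank` (`V_∞` of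
`k⟦X⟧`-rank `≤ 1`) and `hw` (a non-torsion element).  This lane derived both from «`Ē^χ` is a non-zero rank-one lattice over `Λ'`»
(`rank_le_one_modP_of_injective`, `exists_nonTorsion_modP_of_ringHom`), showed that such a lattice is what «f.g. torsion-free of
rank one» means (`exists_injective_linearMap_of_rank_le_one`), discharged the ring-side conditions for `Λ' = 𝒪⟦X⟧`
(`prime_C_and_finiteMultiplicity`, `map_eq_zero_iff_C_dvd`, `exists_module_compatible`) and recovered the card's
«`V_∞ ≅ 𝔽₄⟦T⟧ ⊕ finite`» (`exists_linearEquiv_prod_finite_powerSeries`).  This file COMPOSES: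

* §1 **`rank_le_one_and_exists_nonTorsion_of_lattice`** — lattice `E ↪ R` (≠ 0), `ϖ` prime of finite multiplicity, `φ : R ↠ S` with
  kernel `(ϖ)`, `q : E ↠ V` killing only `ϖE`, compatible `S`-structure ⇒ `hrank ∧ ∃ w, hw` over `S`;
  `…_of_finite_torsionFree` — the same from «`E` f.g. torsion-free of rank `≤ 1`, `E ≠ 0`».
* §2 **`isTorsion_quotient_iff_exists_proj_ne_zero_of_lattice`** — g17's certificate with (`hrank`, `hw`) REPLACED by the lattice data:
  «`μ(Q') = 0 ⟺ ∃ m GNS(m)`» now rests on `Ē^χ ↪ Λ'` non-zero, `2` prime in `Λ'` with finite multiplicities, the reduction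
  `Λ' ↠ 𝔽₄⟦T⟧`, and `V_∞ = Ē^χ/2Ē^χ` — plus the unchanged tower/projection bookkeeping (`hι`, `hN`, `hu`, `hsep`, `hπ`);
  `…_of_finite_torsionFree` — the f.g. torsion-free rank-one form.
* §3 `isTorsion_quotient_iff_exists_proj_ne_zero_powerSeriesLattice` — the instance `Λ' = 𝒪⟦X⟧`, `𝒪` a domain with `WfDvdMonoid`
  (e.g. `ℤ₂[ζ₃]`), `ϖ ∈ 𝒪` prime, `φ = PowerSeries.map (𝒪 ↠ k)`: all ring-side hypotheses discharged;
  `exists_linearEquiv_prod_finite_of_lattice` — «`V_∞ ≅ k⟦X⟧ ⊕ finite`» from the lattice when `k` is finite and `V_∞` f.g.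

Hypothesis ledger after this lane (what a LEAD must still feed for S3 (c)): the ARITHMETIC identifications only — `Ē^χ` f.g.
torsion-free of `Λ'`-rank one (weak Leopoldt / Brumer for the abelian-over-`K` layers), `V_n = 𝓔_n^χ/2` with `hι` (square classes,
`…SquareClasses`), `hN` (`…TowerNorms` / `…CharTwoTower`), and the inverse-limit bookkeeping `hsep`, `hπ`.

[folklore]
-/

set_option autoImplicit false
-- the Theorems namespace of this sub repeats the summit name by design (D-0017 nested layout)
set_option linter.dupNamespace false

open scoped Pointwise

universe u v

namespace Summit.BirchSwinnertonDyer.BirchSwinnertonDyer.Theorems.SignedMuAtTwo.NonsquareDescent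

/-! ## §1 `hrank ∧ hw` from the lattice -/

section Inputs

variable {R : Type*} [CommRing R] [IsDomain R] {E : Type*} [AddCommGroup E] [Module R E]
  {S : Type*} [CommRing S] {V : Type*} [AddCommGroup V] [Module R V] [Module S V]

/-- **`hrank ∧ hw` from a non-zero rank-one lattice.**  `ι : E ↪ R` injective with `E ≠ 0`, `ϖ` prime with finite multiplicity in
non-zero elements, `φ : R →+* S` surjective with `φ r = 0 ↔ ϖ ∣ r`, `q : E ↠ V` `R`-linear with `q e = 0 → e ∈ ϖE`, and
`r • v = φ r • v`: then `V` has `S`-rank `≤ 1` and a non-torsion element — the two inputs of `isTorsion_quotient_span_iff` /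
`isTorsion_quotient_iff_exists_proj_ne_zero`. [folklore] -/
theorem rank_le_one_and_exists_nonTorsion_of_lattice
    (ι : E →ₗ[R] R) (hι : Function.Injective ι) (hE : ∃ e₀ : E, e₀ ≠ 0)
    {ϖ : R} (hϖ : Prime ϖ) (hfin : ∀ a : R, a ≠ 0 → FiniteMultiplicity ϖ a)
    (φ : R →+* S) (hφs : Function.Surjective φ) (hφ : ∀ r : R, φ r = 0 ↔ ϖ ∣ r)
    (q : E →ₗ[R] V) (hq : Function.Surjective q) (hker : ∀ e : E, q e = 0 → ∃ y : E, e = ϖ • y)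
    (hcompat : ∀ (r : R) (v : V), r • v = φ r • v) :
    (∀ v w : V, ∃ a b : S, (a ≠ 0 ∨ b ≠ 0) ∧ a • v + b • w = 0) ∧
      ∃ w : V, ∀ b : S, b ≠ 0 → b • w ≠ 0 := by
  obtain ⟨e₀, he₀⟩ := hE
  exact ⟨rank_le_one_modP_of_injective ι hι ϖ φ hφ
      (fun a ha => (finiteMultiplicity_iff_exists_not_pow_dvd ϖ a).mp (hfin a ha)) q hq hcompat,
    exists_nonTorsion_modP_of_ringHom hϖ hfin ι hι he₀ q hker φ hφs hφ hcompat⟩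

/-- The same from the intrinsic datum «`E` finitely generated, torsion-free, of rank `≤ 1`, non-zero» (the lattice is supplied by
`exists_injective_linearMap_of_rank_le_one'`). [folklore] -/
theorem rank_le_one_and_exists_nonTorsion_of_finite_torsionFree [Module.Finite R E]
    (htf : ∀ (a : R) (e : E), a ≠ 0 → a • e = 0 → e = 0)
    (hrankE : ∀ v w : E, ∃ a b : R, (a ≠ 0 ∨ b ≠ 0) ∧ a • v + b • w = 0) (hE : ∃ e₀ : E, e₀ ≠ 0)
    {ϖ : R} (hϖ : Prime ϖ) (hfin : ∀ a : R, a ≠ 0 → FiniteMultiplicity ϖ a)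
    (φ : R →+* S) (hφs : Function.Surjective φ) (hφ : ∀ r : R, φ r = 0 ↔ ϖ ∣ r)
    (q : E →ₗ[R] V) (hq : Function.Surjective q) (hker : ∀ e : E, q e = 0 → ∃ y : E, e = ϖ • y)
    (hcompat : ∀ (r : R) (v : V), r • v = φ r • v) :
    (∀ v w : V, ∃ a b : S, (a ≠ 0 ∨ b ≠ 0) ∧ a • v + b • w = 0) ∧
      ∃ w : V, ∀ b : S, b ≠ 0 → b • w ≠ 0 := by
  obtain ⟨ι, hι⟩ := exists_injective_linearMap_of_rank_le_one' htf hrankE hE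
  exact rank_le_one_and_exists_nonTorsion_of_lattice ι hι hE hϖ hfin φ hφs hφ q hq hker hcompat

end Inputs

/-! ## §2 The certificate with derived inputs -/

section Certificate

variable {k : Type*} [Field k]
variable (W : ℕ → Type*) [∀ n, AddCommGroup (W n)] [∀ n, Module (PowerSeries k) (W n)]
variable {R : Type*} [CommRing R] [IsDomain R] {E : Type*} [AddCommGroup E] [Module R E]

/-- **«`μ(Q') = 0 ⟺ ∃ m GNS(m)`» (module form) resting on the lattice `Ē^χ ↪ Λ'`.**  g17's `isTorsion_quotient_iff_exists_proj_ne_zero`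
with `hrank`, `hw` DERIVED: squares-dichotomy tower `(W, d, ι, N, u)` over `k⟦X⟧`; a non-zero lattice `ιE : E ↪ R` over a domain `R`
with `ϖ` prime of finite multiplicities; the reduction `φ : R ↠ k⟦X⟧` (kernel `(ϖ)`); `V_∞ = Winf` an `R`-quotient of `E` by (at most)
`ϖE` with compatible `k⟦X⟧`-structure; projections `π n` jointly detecting `0` with `π n uinf = u n`.  Then
`Winf ⧸ ⟨uinf⟩` is torsion iff `u m ≠ 0` for some `m`. [folklore] -/
theorem isTorsion_quotient_iff_exists_proj_ne_zero_of_lattice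
    (d : ℕ → ℕ) (hd : ∀ a, ∃ n, a ≤ d n)
    (ι : ∀ n, W n →ₗ[PowerSeries k] W (n + 1)) (hι : ∀ n, Function.Injective (ι n))
    (N : ∀ n, W (n + 1) →ₗ[PowerSeries k] W n)
    (hN : ∀ n (v : W (n + 1)), ι n (N n v) = (PowerSeries.X : PowerSeries k) ^ (d n) • v)
    (u : ∀ n, W n) (hu : ∀ n, N n (u (n + 1)) = u n)
    (ιE : E →ₗ[R] R) (hιE : Function.Injective ιE) (hE : ∃ e₀ : E, e₀ ≠ 0)
    {ϖ : R} (hϖ : Prime ϖ) (hfin : ∀ a : R, a ≠ 0 → FiniteMultiplicity ϖ a)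
    (φ : R →+* PowerSeries k) (hφs : Function.Surjective φ) (hφ : ∀ r : R, φ r = 0 ↔ ϖ ∣ r)
    {Winf : Type*} [AddCommGroup Winf] [Module R Winf] [Module (PowerSeries k) Winf]
    (hcompat : ∀ (r : R) (v : Winf), r • v = φ r • v)
    (q : E →ₗ[R] Winf) (hq : Function.Surjective q) (hker : ∀ e : E, q e = 0 → ∃ y : E, e = ϖ • y)
    (π : ∀ n, Winf →ₗ[PowerSeries k] W n) (hsep : ∀ v : Winf, (∀ n, π n v = 0) → v = 0)
    (uinf : Winf) (hπ : ∀ n, π n uinf = u n) :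
    (∀ x : Winf ⧸ Submodule.span (PowerSeries k) {uinf}, ∃ b : PowerSeries k, b ≠ 0 ∧ b • x = 0)
      ↔ ∃ m, u m ≠ 0 := by
  obtain ⟨hrank, w, hw⟩ :=
    rank_le_one_and_exists_nonTorsion_of_lattice ιE hιE hE hϖ hfin φ hφs hφ q hq hker hcompat
  exact isTorsion_quotient_iff_exists_proj_ne_zero W d hd ι hι N hN u hu π hsep uinf hπ hrank hw

/-- The same resting on «`E` finitely generated, torsion-free, of `R`-rank `≤ 1`, non-zero» instead of an explicit lattice. [folklore] -/
theorem isTorsion_quotient_iff_exists_proj_ne_zero_of_finite_torsionFree [Module.Finite R E]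
    (d : ℕ → ℕ) (hd : ∀ a, ∃ n, a ≤ d n)
    (ι : ∀ n, W n →ₗ[PowerSeries k] W (n + 1)) (hι : ∀ n, Function.Injective (ι n))
    (N : ∀ n, W (n + 1) →ₗ[PowerSeries k] W n)
    (hN : ∀ n (v : W (n + 1)), ι n (N n v) = (PowerSeries.X : PowerSeries k) ^ (d n) • v)
    (u : ∀ n, W n) (hu : ∀ n, N n (u (n + 1)) = u n)
    (htf : ∀ (a : R) (e : E), a ≠ 0 → a • e = 0 → e = 0)
    (hrankE : ∀ v w : E, ∃ a b : R, (a ≠ 0 ∨ b ≠ 0) ∧ a • v + b • w = 0) (hE : ∃ e₀ : E, e₀ ≠ 0)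
    {ϖ : R} (hϖ : Prime ϖ) (hfin : ∀ a : R, a ≠ 0 → FiniteMultiplicity ϖ a)
    (φ : R →+* PowerSeries k) (hφs : Function.Surjective φ) (hφ : ∀ r : R, φ r = 0 ↔ ϖ ∣ r)
    {Winf : Type*} [AddCommGroup Winf] [Module R Winf] [Module (PowerSeries k) Winf]
    (hcompat : ∀ (r : R) (v : Winf), r • v = φ r • v)
    (q : E →ₗ[R] Winf) (hq : Function.Surjective q) (hker : ∀ e : E, q e = 0 → ∃ y : E, e = ϖ • y)
    (π : ∀ n, Winf →ₗ[PowerSeries k] W n) (hsep : ∀ v : Winf, (∀ n, π n v = 0) → v = 0)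
    (uinf : Winf) (hπ : ∀ n, π n uinf = u n) :
    (∀ x : Winf ⧸ Submodule.span (PowerSeries k) {uinf}, ∃ b : PowerSeries k, b ≠ 0 ∧ b • x = 0)
      ↔ ∃ m, u m ≠ 0 := by
  obtain ⟨ιE, hιE⟩ := exists_injective_linearMap_of_rank_le_one' htf hrankE hE
  exact isTorsion_quotient_iff_exists_proj_ne_zero_of_lattice W d hd ι hι N hN u hu ιE hιE hE hϖ hfin φ hφs hφ
    hcompat q hq hker π hsep uinf hπ

end Certificate

/-! ## §3 The instance `Λ' = 𝒪⟦X⟧`, `φ = PowerSeries.map (𝒪 ↠ k)` -/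

section PowerSeriesLattice

variable {k : Type u} [Field k]
variable (W : ℕ → Type*) [∀ n, AddCommGroup (W n)] [∀ n, Module (PowerSeries k) (W n)]
variable {A : Type*} [CommRing A] [IsDomain A] [WfDvdMonoid A]
  {E : Type*} [AddCommGroup E] [Module (PowerSeries A) E]

/-- **The certificate over `Λ' = 𝒪⟦X⟧` with every ring-side hypothesis discharged.**  `𝒪` a domain with the divisor-chain condition
(`ℤ_[p]`, `ℤ₂[ζ₃]`, any Noetherian domain), `ϖ ∈ 𝒪` prime, `φ₀ : 𝒪 ↠ k` with `φ₀ a = 0 ↔ ϖ ∣ a` (the residue map, `k = 𝒪/ϖ = 𝔽₄`),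
`E ↪ 𝒪⟦X⟧` a non-zero lattice (`Ē^χ`), `Winf = E/ϖE` (any `𝒪⟦X⟧`-quotient of `E` by at most `(C ϖ)E`, with `k⟦X⟧`-structure compatible
with `PowerSeries.map φ₀`), and the squares-dichotomy tower with projections: «`Winf ⧸ ⟨uinf⟩` torsion ⟺ `∃ m, u m ≠ 0`». [folklore] -/
theorem isTorsion_quotient_iff_exists_proj_ne_zero_powerSeriesLattice
    (d : ℕ → ℕ) (hd : ∀ a, ∃ n, a ≤ d n)
    (ι : ∀ n, W n →ₗ[PowerSeries k] W (n + 1)) (hι : ∀ n, Function.Injective (ι n))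
    (N : ∀ n, W (n + 1) →ₗ[PowerSeries k] W n)
    (hN : ∀ n (v : W (n + 1)), ι n (N n v) = (PowerSeries.X : PowerSeries k) ^ (d n) • v)
    (u : ∀ n, W n) (hu : ∀ n, N n (u (n + 1)) = u n)
    (ιE : E →ₗ[PowerSeries A] PowerSeries A) (hιE : Function.Injective ιE) (hE : ∃ e₀ : E, e₀ ≠ 0)
    {ϖ : A} (hϖ : Prime ϖ)
    (φ₀ : A →+* k) (hφ₀s : Function.Surjective φ₀) (hφ₀ : ∀ a : A, φ₀ a = 0 ↔ ϖ ∣ a)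
    {Winf : Type*} [AddCommGroup Winf] [Module (PowerSeries A) Winf] [Module (PowerSeries k) Winf]
    (hcompat : ∀ (r : PowerSeries A) (v : Winf), r • v = PowerSeries.map φ₀ r • v)
    (q : E →ₗ[PowerSeries A] Winf) (hq : Function.Surjective q)
    (hker : ∀ e : E, q e = 0 → ∃ y : E, e = (PowerSeries.C ϖ : PowerSeries A) • y)
    (π : ∀ n, Winf →ₗ[PowerSeries k] W n) (hsep : ∀ v : Winf, (∀ n, π n v = 0) → v = 0)
    (uinf : Winf) (hπ : ∀ n, π n uinf = u n) :
    (∀ x : Winf ⧸ Submodule.span (PowerSeries k) {uinf}, ∃ b : PowerSeries k, b ≠ 0 ∧ b • x = 0)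
      ↔ ∃ m, u m ≠ 0 := by
  obtain ⟨hC, hfin⟩ := prime_C_and_finiteMultiplicity (A := A) hϖ
  exact isTorsion_quotient_iff_exists_proj_ne_zero_of_lattice W d hd ι hι N hN u hu ιE hιE hE hC hfin
    (PowerSeries.map φ₀) (map_surjective_of_surjective φ₀ hφ₀s) (map_eq_zero_iff_C_dvd φ₀ hφ₀)
    hcompat q hq hker π hsep uinf hπ

/-- **«`V_∞ ≅ k⟦X⟧ ⊕ finite`» from the lattice** (`k` a finite field, `V_∞` finitely generated over `k⟦X⟧`): with the same lattice and
reduction data, `Winf ≃ k⟦X⟧ × F` with `F` finite and torsion — the structure the line card states for `V_∞ = Ē^χ/2`. [folklore] -/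
theorem exists_linearEquiv_prod_finite_of_lattice [Finite k]
    (ιE : E →ₗ[PowerSeries A] PowerSeries A) (hιE : Function.Injective ιE) (hE : ∃ e₀ : E, e₀ ≠ 0)
    {ϖ : A} (hϖ : Prime ϖ)
    (φ₀ : A →+* k) (hφ₀s : Function.Surjective φ₀) (hφ₀ : ∀ a : A, φ₀ a = 0 ↔ ϖ ∣ a)
    {Winf : Type v} [AddCommGroup Winf] [Module (PowerSeries A) Winf] [Module (PowerSeries k) Winf]
    [Module.Finite (PowerSeries k) Winf]
    (hcompat : ∀ (r : PowerSeries A) (v : Winf), r • v = PowerSeries.map φ₀ r • v)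
    (q : E →ₗ[PowerSeries A] Winf) (hq : Function.Surjective q)
    (hker : ∀ e : E, q e = 0 → ∃ y : E, e = (PowerSeries.C ϖ : PowerSeries A) • y) :
    ∃ (F : Type u) (_ : AddCommGroup F) (_ : Module (PowerSeries k) F),
      Finite F ∧ (∀ f : F, ∃ c : PowerSeries k, c ≠ 0 ∧ c • f = 0) ∧
        Nonempty (Winf ≃ₗ[PowerSeries k] (PowerSeries k × F)) := by
  obtain ⟨hC, hfin⟩ := prime_C_and_finiteMultiplicity (A := A) hϖ
  obtain ⟨hrank, hw⟩ := rank_le_one_and_exists_nonTorsion_of_lattice ιE hιE hE hC hfin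
    (PowerSeries.map φ₀) (map_surjective_of_surjective φ₀ hφ₀s) (map_eq_zero_iff_C_dvd φ₀ hφ₀) q hq hker hcompat
  exact exists_linearEquiv_prod_finite_powerSeries hrank hw

end PowerSeriesLattice

end Summit.BirchSwinnertonDyer.BirchSwinnertonDyer.Theorems.SignedMuAtTwo.NonsquareDescent
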